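import Literature.MathematicalPhysics.QuantumFieldTheory.Balaban1983to89.BlockAveraging
import HarnessLib

/-!
# S2β · `hFlat` road, brick (G9) of UV3-NODE §64.2 (erratum 07:45Z) — THE PLAQUETTE WORD OF THE RECORD's AVERAGE `avgFun ℰ` IN LOOP FORM:
# `Ū(c₁)·Ū(c₂)·Ū(c₃)⁻¹·Ū(c₄)⁻¹ = E₁ · E₂^{A₁} · (E₃⁻¹)^{A₁A₂A₃⁻¹} · (E₄⁻¹)^{H₀} · H₀`, every `E`-factor a small-loop average of (conjugated,
# inverted) LOOP variables with the SAME `dist1`, `H₀ = A₁A₂A₃⁻¹A₄⁻¹` the straight-transporter holonomy — so every context of the hybrid step is FLUX-small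

Cell `ym3-torus` (rung R3 = continuum `SU(2)` Yang–Mills on the three-torus — NOT d = 4, NOT infinite volume, NOT a mass gap, NOT Clay).
Width seat «width 8» `ym3-torus-px8` (gen 21), FREE px helper on crux `stmt-QuantumFields-20520`, count-neutral, DEFINITION-FREE.

WHY.  The record's one-step average is `avgFun ℰ U c = corr ℰ U c * axialAvg U c` (lit `BlockAveraging` §3) with `corr = ℰ.avg (loopHol U c)` on the
small-field domain: the members of the exp-mean-log are LOOPS (flux variables), the straight transporter `axialAvg U c` carries the bond SIZES.  Rewriting the
plaquette word by conjugation moves every straight transporter into (i) conjugations of loop families — which the axioms (0.5)∕(0.6) push INSIDE the average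
(`avg_inv`, `avg_conj`) without changing any `dist1` (`dist1_conj`, `dist1_inv`) — and (ii) ONE straight holonomy `H₀`, itself a product of `L²` fine plaquettes
(lasso, ✓`…CornerSquareStokes`).  Hence in UV3-NODE §64.2 the hybrid contexts are flux-small (`σ_t ≤ C·L²·θ_{t−1}`) and NO bond-size profile `s_t` enters the
KEY LEMMA (px16 g20's 07:41:14Z finding concerns (B), not (C)).
* §1 `word_conj_rewrite` — the group identity.
* §2 ★★ `plaqWord_avgFun_eq_loopForm` — the identity for `avgFun ℰ U` on the small-field domain of the four bonds, with the three conjugated∕inverted loop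
  families DISPLAYED; `dist1_conj_family`, `dist1_conj_inv_family` — their members have the `dist1` of the original loops; `small_conj_inv_family` — they stay
  in the domain of the axioms.

HONEST SCOPE.  Group algebra over the axioms (0.5)–(0.6) of an abstract small-loop average; nothing of Bałaban's analysis; which four bonds form a plaquette and
the lasso bound on `H₀` are the assembler's (✓p814030); the KEY LEMMA, the recursion, `hFlat`, TUBE-REG∘, GAP♯∘, S2β, crux 20520 and `YM3TorusSU2` are NOT
proved; no registered stub is closed; the Yang–Mills mass gap is NOT proved.
References: T. Bałaban, CMP **109** (1987) [Balaban1987RG1] ((0.4)–(0.7) p.253); T. Bałaban, CMP **98** (1985) [Balaban1985Averaging] ((8), (11)).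
-/

set_option autoImplicit false

noncomputable section

namespace Summit.QuantumFields.YangMills.Theorems.FluctuationComparisonRegPrIntLS2BetaPlaquetteWordLoopForm

open Literature.MathematicalPhysics.QuantumFieldTheory.Balaban1983to89
open Literature.MathematicalPhysics.QuantumFieldTheory.Balaban1983to89.T4Continuum
open Literature.MathematicalPhysics.QuantumFieldTheory.Balaban1983to89.AveragingRT
open Literature.MathematicalPhysics.QuantumFieldTheory.Balaban1983to89.BlockAveraging

/-! ## §1 The group identity -/

section GroupIdentity

variable {G : Type*} [Group G]

/-- ★ **CONJUGATION REWRITE OF A PLAQUETTE WORD**: `(E₁A₁)(E₂A₂)(E₃A₃)⁻¹(E₄A₄)⁻¹ = E₁ · (A₁E₂A₁⁻¹) · (P₃E₃⁻¹P₃⁻¹) · (H₀E₄⁻¹H₀⁻¹) · H₀` with `P₃ = A₁A₂A₃⁻¹`,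
`H₀ = A₁A₂A₃⁻¹A₄⁻¹`. [folklore] -/
theorem word_conj_rewrite (E₁ E₂ E₃ E₄ A₁ A₂ A₃ A₄ : G) :
    (E₁ * A₁) * (E₂ * A₂) * (E₃ * A₃)⁻¹ * (E₄ * A₄)⁻¹ =
      E₁ * (A₁ * E₂ * A₁⁻¹) * ((A₁ * A₂ * A₃⁻¹) * E₃⁻¹ * (A₁ * A₂ * A₃⁻¹)⁻¹) *
        ((A₁ * A₂ * A₃⁻¹ * A₄⁻¹) * E₄⁻¹ * (A₁ * A₂ * A₃⁻¹ * A₄⁻¹)⁻¹) * (A₁ * A₂ * A₃⁻¹ * A₄⁻¹) := by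
  group

end GroupIdentity

/-! ## §2 The plaquette word of `avgFun ℰ` in loop form -/

section LoopForm

variable {P : Params} {j : ℕ} {G : Type*} [GaugeGroup G] (ℰ : LoopAverage G)

/-- On the small-field domain the correction factor IS the small-loop average of the loop family. [cite: Balaban1987RG1, (0.4) p.253] -/
theorem corr_eq_avg_of_small {U : GaugeField P j G} {c : PBond P (j + 1)} (h : Small ℰ U c) : corr ℰ U c = ℰ.avg (loopHol U c) := by
  unfold corr; rw [if_pos h]

/-- Conjugated members have the same `dist1`. [folklore] -/
theorem dist1_conj_family {ι : Type*} (W : ι → G) (u : G) (i : ι) : dist1 (u * W i * u⁻¹) = dist1 (W i) :=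
  GaugeGroup.dist1_conj _ _

/-- Conjugated inverted members have the same `dist1`. [folklore] -/
theorem dist1_conj_inv_family {ι : Type*} (W : ι → G) (u : G) (i : ι) : dist1 (u * (W i)⁻¹ * u⁻¹) = dist1 (W i) := by
  rw [GaugeGroup.dist1_conj, GaugeGroup.dist1_inv]

/-- Conjugated inverted small families are small. [folklore] -/
theorem small_conj_inv_family {ι : Type*} {W : ι → G} (hW : ∀ i, dist1 (W i) < ℰ.δ) (u : G) :
    (∀ i, dist1 (u * W i * u⁻¹) < ℰ.δ) ∧ (∀ i, dist1 (u * (W i)⁻¹ * u⁻¹) < ℰ.δ) ∧ ∀ i, dist1 (W i)⁻¹ < ℰ.δ :=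
  ⟨fun i => by rw [dist1_conj_family]; exact hW i, fun i => by rw [dist1_conj_inv_family]; exact hW i,
    fun i => by rw [GaugeGroup.dist1_inv]; exact hW i⟩

/-- `(0.5) + (0.6)`: the conjugated inverse of a small-loop average is the average of the conjugated inverted family. [cite: Balaban1987RG1, (0.5)-(0.6) p.253] -/
theorem conj_inv_avg_eq {ι : Type*} [Fintype ι] [Nonempty ι] (W : ι → G) (hW : ∀ i, dist1 (W i) < ℰ.δ) (u : G) :
    u * (ℰ.avg W)⁻¹ * u⁻¹ = ℰ.avg (fun i => u * (W i)⁻¹ * u⁻¹) := by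
  rw [← ℰ.avg_inv W hW, ← ℰ.avg_conj _ (small_conj_inv_family ℰ hW u).2.2 u]

/-- ★★ **THE PLAQUETTE WORD OF `avgFun ℰ` IN LOOP FORM**: on the small-field domain of the four coarse bonds, with `A_m := axialAvg U c_m` (straight transporters),
`P₃ := A₁A₂A₃⁻¹`, `H₀ := A₁A₂A₃⁻¹A₄⁻¹` (the straight holonomy):
`Ū(c₁)·Ū(c₂)·Ū(c₃)⁻¹·Ū(c₄)⁻¹ = ℰ.avg(loops₁) · ℰ.avg(A₁·loops₂·A₁⁻¹) · ℰ.avg(P₃·loops₃⁻¹·P₃⁻¹) · ℰ.avg(H₀·loops₄⁻¹·H₀⁻¹) · H₀` — every averaged factor is a small-loop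
average of a family with the `dist1` of the original loop variables (`dist1_conj_family`, `dist1_conj_inv_family`): the hybrid contexts of UV3-NODE §64.2 are FLUX-small.
[cite: Balaban1987RG1, (0.4)-(0.6) p.253] -/
theorem plaqWord_avgFun_eq_loopForm (U : GaugeField P j G) (c₁ c₂ c₃ c₄ : PBond P (j + 1))
    (h₁ : Small ℰ U c₁) (h₂ : Small ℰ U c₂) (h₃ : Small ℰ U c₃) (h₄ : Small ℰ U c₄) :
    avgFun ℰ U c₁ * avgFun ℰ U c₂ * (avgFun ℰ U c₃)⁻¹ * (avgFun ℰ U c₄)⁻¹ =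
      ℰ.avg (loopHol U c₁) *
        ℰ.avg (fun i => axialAvg U c₁ * loopHol U c₂ i * (axialAvg U c₁)⁻¹) *
        ℰ.avg (fun i => (axialAvg U c₁ * axialAvg U c₂ * (axialAvg U c₃)⁻¹) * (loopHol U c₃ i)⁻¹ *
          (axialAvg U c₁ * axialAvg U c₂ * (axialAvg U c₃)⁻¹)⁻¹) *
        ℰ.avg (fun i => (axialAvg U c₁ * axialAvg U c₂ * (axialAvg U c₃)⁻¹ * (axialAvg U c₄)⁻¹) * (loopHol U c₄ i)⁻¹ *
          (axialAvg U c₁ * axialAvg U c₂ * (axialAvg U c₃)⁻¹ * (axialAvg U c₄)⁻¹)⁻¹) *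
        (axialAvg U c₁ * axialAvg U c₂ * (axialAvg U c₃)⁻¹ * (axialAvg U c₄)⁻¹) := by
  have e : ∀ c, avgFun ℰ U c = corr ℰ U c * axialAvg U c := fun c => rfl
  rw [e, e, e, e, corr_eq_avg_of_small ℰ h₁, corr_eq_avg_of_small ℰ h₂, corr_eq_avg_of_small ℰ h₃, corr_eq_avg_of_small ℰ h₄,
    word_conj_rewrite, ℰ.avg_conj _ h₂, conj_inv_avg_eq ℰ _ h₃, conj_inv_avg_eq ℰ _ h₄]

end LoopForm

end Summit.QuantumFields.YangMills.Theorems.FluctuationComparisonRegPrIntLS2BetaPlaquetteWordLoopForm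

end
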